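/-
Copyright: the b2b-balaban T⁴-continuum CRUX team, row NE7b OWNER lineage `t4-ne7b-p1` (gen 146). Project licence.
-/
import Summits.QuantumFields.BalabanUV.T4Continuum.Spine.NE7b.SupFivePointCutFullGraphTwo

/-!
# THE ORDER-FIVE THRESHOLD UNDER THE FULL-GRAPH PRODUCT — THE END OF THE FIVE-POINT PIECE IN THE WEIGHTED CLASS (SCOPING-d17 §F).
# (557) bounds the tilted fifth cumulant by `C5·t⋆⁴`, `t⋆ =` the least of the fifteen cut maxima of `r⁻¹` (WRITTEN OUT in (610)'s `M₅`);
# (558) summed `t⋆⁴` over the free sites WITHOUT weights via the rooted greedy polynomial.  The WEIGHTED slot letters need `t⋆⁴·Π_{pairs}ϑ`.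
# THIS FILE assembles (681)∕(682)'s weighted greedy induction over the fifteen cuts: for the class's tree weight `r ≥ 1` and a slower
# kernel `r₁ ≥ 1`, symmetric, submultiplicative with `r₁⁸ ≤ r`,
#   `t⋆(r⁻¹)(x,y,z,t,s)⁴ ≤ Π_{10 pairs p} r₁(p)⁻¹`
# (`pow4_prod_le_one_of_cuts`: the `1 + 4 + 12 + 24` reached lists from the root `x`, each cut disjunction read off `T ≤ max(…)` by `le_max_iff`
# and converted by `T·r₁⁸ ≤ T·r ≤ r⁻¹·r = 1`).  With `Π_{pairs}ϑ ≤ Π_{pairs} r₁^{…}`-type compatibilities the five-point term's weighted slot sums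
# factor site by site (next files) (row NE7b, node U5c; (681), (682) BY NAME; Mathlib only through them; [folklore]).

Cell `pub-balaban`, sub-cell `t4`, spine estimate NE7b (`T4WeightBudget.RelWeightBound`; the cell's OWN estimate — NOT PRINTED in
[Bałaban 1983–89], NOT PROVED).  Crux-route work under `Spine/NE7b/` by the row OWNER (`t4-ne7b-p1` gen 146, file (683)) under FREEZE
(0)'s crux-prover clause; NOTHING of Bałaban's is named as a Lean object, valued or asserted; no `T4Continuum/Support` leaf typed; no
`def`, no notation (`t⋆` WRITTEN OUT as printed by (610)); zero `sorry`.  Imports (BY NAME): the OWNER's (682) `…SupFivePointCutFullGraphTwo`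
((681) through it).

WHAT IS PROVED ([folklore]): **`pow4_prod_le_one_of_cuts`**, THE END **`threshold_pow4_le_fullgraph`**; toy.

HONEST (what this is NOT).  Finite algebra over five sites; the interpolated entry majorant `M₅′` and its weighted slot letters are the next
files; the rate cost `r₁⁸ ≤ r` is booked, not optimised.  Scalar skeleton ((A3), NC-NE7b-α UNRULED); nothing of Bałaban's asserted.  BY-NAME
EFFECT ON THE WALL: NONE.  NE7b NOT PRINTED ∕ NOT PROVED; spine PROVED 0∕9; rung (B)+1 — the programme's measures remain FINITE-torus
statements; NOT the mass gap, NOT Clay.  HONEST DEPENDENCY: continuum YM on T⁴ ⇐ BetaPertH ∧ nine spine estimates (0∕9 proved); BetaPertH ⇐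
(D1) ∧ (D4) ∧ CAP+tail; G-an2-4 gates asym, D1 and NE2∕3∕4.
-/

set_option autoImplicit false

namespace Summit.QuantumFields.BalabanUV.T4Continuum.NE7b.SupFivePointThresholdFullGraph

open SupFivePointCutFullGraph (cut_level4 cut_level3)
open SupFivePointCutFullGraphTwo (cut_level2 cut_level1)

variable {ι : Type} {r r₁ : ι → ι → ℝ} {T : ℝ}

set_option maxHeartbeats 1600000 in
/-- **From the fifteen cut maxima to the full-graph product**: if `T ≥ 0` lies below each of the fifteen cut maxima of `r⁻¹` (the
components of (557)'s `t⋆`) and `r₁ ≥ 1` is symmetric, submultiplicative with `r₁⁸ ≤ r`, then `T⁴·Π_{10 pairs} r₁ ≤ 1`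
((681)∕(682)'s four levels assembled over the `1 + 4 + 12 + 24` reached lists). [folklore] -/
theorem pow4_prod_le_one_of_cuts (hT : 0 ≤ T) (hr0 : ∀ x y, 0 < r x y) (h1 : ∀ x y, 1 ≤ r₁ x y) (hsymm : ∀ x y, r₁ x y = r₁ y x)
    (hmul : ∀ x y z, r₁ x z ≤ r₁ x y * r₁ y z) (h8 : ∀ x y, r₁ x y ^ 8 ≤ r x y) (x y z t s : ι)
    (hc1 : T ≤ (max (r x y)⁻¹ (max (r x z)⁻¹ (max (r x t)⁻¹ (r x s)⁻¹))))
    (hc2 : T ≤ (max (r x z)⁻¹ (max (r y z)⁻¹ (max (r x t)⁻¹ (max (r y t)⁻¹ (max (r x s)⁻¹ (r y s)⁻¹))))))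
    (hc3 : T ≤ (max (r x y)⁻¹ (max (r y z)⁻¹ (max (r x t)⁻¹ (max (r z t)⁻¹ (max (r x s)⁻¹ (r z s)⁻¹))))))
    (hc4 : T ≤ (max (r x y)⁻¹ (max (r y t)⁻¹ (max (r x z)⁻¹ (max (r z t)⁻¹ (max (r x s)⁻¹ (r t s)⁻¹))))))
    (hc5 : T ≤ (max (r x y)⁻¹ (max (r y s)⁻¹ (max (r x z)⁻¹ (max (r z s)⁻¹ (max (r x t)⁻¹ (r t s)⁻¹))))))
    (hc6 : T ≤ (max (r x t)⁻¹ (max (r y t)⁻¹ (max (r z t)⁻¹ (max (r x s)⁻¹ (max (r y s)⁻¹ (r z s)⁻¹))))))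
    (hc7 : T ≤ (max (r x z)⁻¹ (max (r y z)⁻¹ (max (r z t)⁻¹ (max (r x s)⁻¹ (max (r y s)⁻¹ (r t s)⁻¹))))))
    (hc8 : T ≤ (max (r x z)⁻¹ (max (r y z)⁻¹ (max (r z s)⁻¹ (max (r x t)⁻¹ (max (r y t)⁻¹ (r t s)⁻¹))))))
    (hc9 : T ≤ (max (r x y)⁻¹ (max (r y z)⁻¹ (max (r y t)⁻¹ (max (r x s)⁻¹ (max (r z s)⁻¹ (r t s)⁻¹))))))
    (hc10 : T ≤ (max (r x y)⁻¹ (max (r y z)⁻¹ (max (r y s)⁻¹ (max (r x t)⁻¹ (max (r z t)⁻¹ (r t s)⁻¹))))))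
    (hc11 : T ≤ (max (r x y)⁻¹ (max (r y t)⁻¹ (max (r y s)⁻¹ (max (r x z)⁻¹ (max (r z t)⁻¹ (r z s)⁻¹))))))
    (hc12 : T ≤ (max (r x s)⁻¹ (max (r y s)⁻¹ (max (r z s)⁻¹ (r t s)⁻¹))))
    (hc13 : T ≤ (max (r x t)⁻¹ (max (r y t)⁻¹ (max (r z t)⁻¹ (r t s)⁻¹))))
    (hc14 : T ≤ (max (r x z)⁻¹ (max (r y z)⁻¹ (max (r z t)⁻¹ (r z s)⁻¹))))
    (hc15 : T ≤ (max (r x y)⁻¹ (max (r y z)⁻¹ (max (r y t)⁻¹ (r y s)⁻¹)))) :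
    T ^ 4 * (r₁ x y * r₁ x z * r₁ x t * r₁ x s * r₁ y z * r₁ y t * r₁ y s * r₁ z t * r₁ z s * r₁ t s) ≤ 1 := by
  have hr0' : ∀ a b, 0 ≤ r a b := fun a b => (hr0 a b).le
  have conv : ∀ a b, T ≤ (r a b)⁻¹ → T * r₁ a b ^ 8 ≤ 1 := fun a b h =>
    calc T * r₁ a b ^ 8 ≤ T * r a b := mul_le_mul_of_nonneg_left (h8 a b) hT
      _ ≤ (r a b)⁻¹ * r a b := mul_le_mul_of_nonneg_right h (hr0' a b)
      _ = 1 := inv_mul_cancel₀ (hr0 a b).ne'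
  have conv' : ∀ a b, T ≤ (r a b)⁻¹ → T * r₁ b a ^ 8 ≤ 1 := fun a b h => by rw [hsymm b a]; exact conv a b h
  have src_x := hc1
  simp only [le_max_iff] at src_x
  have src_xy := hc2
  simp only [le_max_iff] at src_xy
  have src_xz := hc3
  simp only [le_max_iff] at src_xz
  have src_xt := hc4
  simp only [le_max_iff] at src_xt
  have src_xs := hc5
  simp only [le_max_iff] at src_xs
  have src_xyz := hc6
  simp only [le_max_iff] at src_xyz
  have src_xyt := hc7
  simp only [le_max_iff] at src_xyt
  have src_xys := hc8
  simp only [le_max_iff] at src_xys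
  have src_xzt := hc9
  simp only [le_max_iff] at src_xzt
  have src_xzs := hc10
  simp only [le_max_iff] at src_xzs
  have src_xts := hc11
  simp only [le_max_iff] at src_xts
  have src_xyzt := hc12
  simp only [le_max_iff] at src_xyzt
  have src_xyzs := hc13
  simp only [le_max_iff] at src_xyzs
  have src_xyts := hc14
  simp only [le_max_iff] at src_xyts
  have src_xzts := hc15
  simp only [le_max_iff] at src_xzts
  have f_xyzt_s := cut_level4 hT h1 hsymm hmul x y z t s (Or.elim src_xyzt (fun e => (Or.inl (conv x s e))) (fun h1 => (Or.elim h1 (fun e =>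
        (Or.inr (Or.inl (conv y s e)))) (fun h2 => (Or.elim h2 (fun e => (Or.inr (Or.inr (Or.inl (conv z s e))))) (fun e => (Or.inr (Or.inr (Or.inr
        (conv t s e))))))))))
  have f_xyzs_t := cut_level4 hT h1 hsymm hmul x y z s t (Or.elim src_xyzs (fun e => (Or.inl (conv x t e))) (fun h1 => (Or.elim h1 (fun e =>
        (Or.inr (Or.inl (conv y t e)))) (fun h2 => (Or.elim h2 (fun e => (Or.inr (Or.inr (Or.inl (conv z t e))))) (fun e => (Or.inr (Or.inr (Or.inr
        (conv' t s e))))))))))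
  have f_xytz_s := cut_level4 hT h1 hsymm hmul x y t z s (Or.elim src_xyzt (fun e => (Or.inl (conv x s e))) (fun h1 => (Or.elim h1 (fun e =>
        (Or.inr (Or.inl (conv y s e)))) (fun h2 => (Or.elim h2 (fun e => (Or.inr (Or.inr (Or.inr (conv z s e))))) (fun e => (Or.inr (Or.inr (Or.inl
        (conv t s e))))))))))
  have f_xyts_z := cut_level4 hT h1 hsymm hmul x y t s z (Or.elim src_xyts (fun e => (Or.inl (conv x z e))) (fun h1 => (Or.elim h1 (fun e =>
        (Or.inr (Or.inl (conv y z e)))) (fun h2 => (Or.elim h2 (fun e => (Or.inr (Or.inr (Or.inl (conv' z t e))))) (fun e => (Or.inr (Or.inr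
        (Or.inr (conv' z s e))))))))))
  have f_xysz_t := cut_level4 hT h1 hsymm hmul x y s z t (Or.elim src_xyzs (fun e => (Or.inl (conv x t e))) (fun h1 => (Or.elim h1 (fun e =>
        (Or.inr (Or.inl (conv y t e)))) (fun h2 => (Or.elim h2 (fun e => (Or.inr (Or.inr (Or.inr (conv z t e))))) (fun e => (Or.inr (Or.inr (Or.inl
        (conv' t s e))))))))))
  have f_xyst_z := cut_level4 hT h1 hsymm hmul x y s t z (Or.elim src_xyts (fun e => (Or.inl (conv x z e))) (fun h1 => (Or.elim h1 (fun e =>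
        (Or.inr (Or.inl (conv y z e)))) (fun h2 => (Or.elim h2 (fun e => (Or.inr (Or.inr (Or.inr (conv' z t e))))) (fun e => (Or.inr (Or.inr
        (Or.inl (conv' z s e))))))))))
  have f_xzyt_s := cut_level4 hT h1 hsymm hmul x z y t s (Or.elim src_xyzt (fun e => (Or.inl (conv x s e))) (fun h1 => (Or.elim h1 (fun e =>
        (Or.inr (Or.inr (Or.inl (conv y s e))))) (fun h2 => (Or.elim h2 (fun e => (Or.inr (Or.inl (conv z s e)))) (fun e => (Or.inr (Or.inr (Or.inr
        (conv t s e))))))))))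
  have f_xzys_t := cut_level4 hT h1 hsymm hmul x z y s t (Or.elim src_xyzs (fun e => (Or.inl (conv x t e))) (fun h1 => (Or.elim h1 (fun e =>
        (Or.inr (Or.inr (Or.inl (conv y t e))))) (fun h2 => (Or.elim h2 (fun e => (Or.inr (Or.inl (conv z t e)))) (fun e => (Or.inr (Or.inr (Or.inr
        (conv' t s e))))))))))
  have f_xzty_s := cut_level4 hT h1 hsymm hmul x z t y s (Or.elim src_xyzt (fun e => (Or.inl (conv x s e))) (fun h1 => (Or.elim h1 (fun e =>
        (Or.inr (Or.inr (Or.inr (conv y s e))))) (fun h2 => (Or.elim h2 (fun e => (Or.inr (Or.inl (conv z s e)))) (fun e => (Or.inr (Or.inr (Or.inl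
        (conv t s e))))))))))
  have f_xzts_y := cut_level4 hT h1 hsymm hmul x z t s y (Or.elim src_xzts (fun e => (Or.inl (conv x y e))) (fun h1 => (Or.elim h1 (fun e =>
        (Or.inr (Or.inl (conv' y z e)))) (fun h2 => (Or.elim h2 (fun e => (Or.inr (Or.inr (Or.inl (conv' y t e))))) (fun e => (Or.inr (Or.inr
        (Or.inr (conv' y s e))))))))))
  have f_xzsy_t := cut_level4 hT h1 hsymm hmul x z s y t (Or.elim src_xyzs (fun e => (Or.inl (conv x t e))) (fun h1 => (Or.elim h1 (fun e =>
        (Or.inr (Or.inr (Or.inr (conv y t e))))) (fun h2 => (Or.elim h2 (fun e => (Or.inr (Or.inl (conv z t e)))) (fun e => (Or.inr (Or.inr (Or.inl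
        (conv' t s e))))))))))
  have f_xzst_y := cut_level4 hT h1 hsymm hmul x z s t y (Or.elim src_xzts (fun e => (Or.inl (conv x y e))) (fun h1 => (Or.elim h1 (fun e =>
        (Or.inr (Or.inl (conv' y z e)))) (fun h2 => (Or.elim h2 (fun e => (Or.inr (Or.inr (Or.inr (conv' y t e))))) (fun e => (Or.inr (Or.inr
        (Or.inl (conv' y s e))))))))))
  have f_xtyz_s := cut_level4 hT h1 hsymm hmul x t y z s (Or.elim src_xyzt (fun e => (Or.inl (conv x s e))) (fun h1 => (Or.elim h1 (fun e =>
        (Or.inr (Or.inr (Or.inl (conv y s e))))) (fun h2 => (Or.elim h2 (fun e => (Or.inr (Or.inr (Or.inr (conv z s e))))) (fun e => (Or.inr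
        (Or.inl (conv t s e)))))))))
  have f_xtys_z := cut_level4 hT h1 hsymm hmul x t y s z (Or.elim src_xyts (fun e => (Or.inl (conv x z e))) (fun h1 => (Or.elim h1 (fun e =>
        (Or.inr (Or.inr (Or.inl (conv y z e))))) (fun h2 => (Or.elim h2 (fun e => (Or.inr (Or.inl (conv' z t e)))) (fun e => (Or.inr (Or.inr
        (Or.inr (conv' z s e))))))))))
  have f_xtzy_s := cut_level4 hT h1 hsymm hmul x t z y s (Or.elim src_xyzt (fun e => (Or.inl (conv x s e))) (fun h1 => (Or.elim h1 (fun e =>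
        (Or.inr (Or.inr (Or.inr (conv y s e))))) (fun h2 => (Or.elim h2 (fun e => (Or.inr (Or.inr (Or.inl (conv z s e))))) (fun e => (Or.inr
        (Or.inl (conv t s e)))))))))
  have f_xtzs_y := cut_level4 hT h1 hsymm hmul x t z s y (Or.elim src_xzts (fun e => (Or.inl (conv x y e))) (fun h1 => (Or.elim h1 (fun e =>
        (Or.inr (Or.inr (Or.inl (conv' y z e))))) (fun h2 => (Or.elim h2 (fun e => (Or.inr (Or.inl (conv' y t e)))) (fun e => (Or.inr (Or.inr
        (Or.inr (conv' y s e))))))))))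
  have f_xtsy_z := cut_level4 hT h1 hsymm hmul x t s y z (Or.elim src_xyts (fun e => (Or.inl (conv x z e))) (fun h1 => (Or.elim h1 (fun e =>
        (Or.inr (Or.inr (Or.inr (conv y z e))))) (fun h2 => (Or.elim h2 (fun e => (Or.inr (Or.inl (conv' z t e)))) (fun e => (Or.inr (Or.inr
        (Or.inl (conv' z s e))))))))))
  have f_xtsz_y := cut_level4 hT h1 hsymm hmul x t s z y (Or.elim src_xzts (fun e => (Or.inl (conv x y e))) (fun h1 => (Or.elim h1 (fun e =>
        (Or.inr (Or.inr (Or.inr (conv' y z e))))) (fun h2 => (Or.elim h2 (fun e => (Or.inr (Or.inl (conv' y t e)))) (fun e => (Or.inr (Or.inr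
        (Or.inl (conv' y s e))))))))))
  have f_xsyz_t := cut_level4 hT h1 hsymm hmul x s y z t (Or.elim src_xyzs (fun e => (Or.inl (conv x t e))) (fun h1 => (Or.elim h1 (fun e =>
        (Or.inr (Or.inr (Or.inl (conv y t e))))) (fun h2 => (Or.elim h2 (fun e => (Or.inr (Or.inr (Or.inr (conv z t e))))) (fun e => (Or.inr
        (Or.inl (conv' t s e)))))))))
  have f_xsyt_z := cut_level4 hT h1 hsymm hmul x s y t z (Or.elim src_xyts (fun e => (Or.inl (conv x z e))) (fun h1 => (Or.elim h1 (fun e =>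
        (Or.inr (Or.inr (Or.inl (conv y z e))))) (fun h2 => (Or.elim h2 (fun e => (Or.inr (Or.inr (Or.inr (conv' z t e))))) (fun e => (Or.inr
        (Or.inl (conv' z s e)))))))))
  have f_xszy_t := cut_level4 hT h1 hsymm hmul x s z y t (Or.elim src_xyzs (fun e => (Or.inl (conv x t e))) (fun h1 => (Or.elim h1 (fun e =>
        (Or.inr (Or.inr (Or.inr (conv y t e))))) (fun h2 => (Or.elim h2 (fun e => (Or.inr (Or.inr (Or.inl (conv z t e))))) (fun e => (Or.inr
        (Or.inl (conv' t s e)))))))))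
  have f_xszt_y := cut_level4 hT h1 hsymm hmul x s z t y (Or.elim src_xzts (fun e => (Or.inl (conv x y e))) (fun h1 => (Or.elim h1 (fun e =>
        (Or.inr (Or.inr (Or.inl (conv' y z e))))) (fun h2 => (Or.elim h2 (fun e => (Or.inr (Or.inr (Or.inr (conv' y t e))))) (fun e => (Or.inr
        (Or.inl (conv' y s e)))))))))
  have f_xsty_z := cut_level4 hT h1 hsymm hmul x s t y z (Or.elim src_xyts (fun e => (Or.inl (conv x z e))) (fun h1 => (Or.elim h1 (fun e =>
        (Or.inr (Or.inr (Or.inr (conv y z e))))) (fun h2 => (Or.elim h2 (fun e => (Or.inr (Or.inr (Or.inl (conv' z t e))))) (fun e => (Or.inr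
        (Or.inl (conv' z s e)))))))))
  have f_xstz_y := cut_level4 hT h1 hsymm hmul x s t z y (Or.elim src_xzts (fun e => (Or.inl (conv x y e))) (fun h1 => (Or.elim h1 (fun e =>
        (Or.inr (Or.inr (Or.inr (conv' y z e))))) (fun h2 => (Or.elim h2 (fun e => (Or.inr (Or.inr (Or.inl (conv' y t e))))) (fun e => (Or.inr
        (Or.inl (conv' y s e)))))))))
  have f_xyz_ts := cut_level3 hT h1 hsymm hmul x y z t s (Or.elim src_xyz (fun e => (Or.inl (conv x t e))) (fun h1 => (Or.elim h1 (fun e => (Or.inr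
        (Or.inl (conv y t e)))) (fun h2 => (Or.elim h2 (fun e => (Or.inr (Or.inr (Or.inl (conv z t e))))) (fun h3 => (Or.elim h3 (fun e => (Or.inr
        (Or.inr (Or.inr (Or.inl (conv x s e)))))) (fun h4 => (Or.elim h4 (fun e => (Or.inr (Or.inr (Or.inr (Or.inr (Or.inl (conv y s e))))))) (fun
        e => (Or.inr (Or.inr (Or.inr (Or.inr (Or.inr (conv z s e)))))))))))))))) f_xyzt_s f_xyzs_t
  have f_xyt_zs := cut_level3 hT h1 hsymm hmul x y t z s (Or.elim src_xyt (fun e => (Or.inl (conv x z e))) (fun h1 => (Or.elim h1 (fun e => (Or.inr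
        (Or.inl (conv y z e)))) (fun h2 => (Or.elim h2 (fun e => (Or.inr (Or.inr (Or.inl (conv' z t e))))) (fun h3 => (Or.elim h3 (fun e => (Or.inr
        (Or.inr (Or.inr (Or.inl (conv x s e)))))) (fun h4 => (Or.elim h4 (fun e => (Or.inr (Or.inr (Or.inr (Or.inr (Or.inl (conv y s e))))))) (fun
        e => (Or.inr (Or.inr (Or.inr (Or.inr (Or.inr (conv t s e)))))))))))))))) f_xytz_s f_xyts_z
  have f_xys_zt := cut_level3 hT h1 hsymm hmul x y s z t (Or.elim src_xys (fun e => (Or.inl (conv x z e))) (fun h1 => (Or.elim h1 (fun e => (Or.inr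
        (Or.inl (conv y z e)))) (fun h2 => (Or.elim h2 (fun e => (Or.inr (Or.inr (Or.inl (conv' z s e))))) (fun h3 => (Or.elim h3 (fun e => (Or.inr
        (Or.inr (Or.inr (Or.inl (conv x t e)))))) (fun h4 => (Or.elim h4 (fun e => (Or.inr (Or.inr (Or.inr (Or.inr (Or.inl (conv y t e))))))) (fun
        e => (Or.inr (Or.inr (Or.inr (Or.inr (Or.inr (conv' t s e)))))))))))))))) f_xysz_t f_xyst_z
  have f_xzy_ts := cut_level3 hT h1 hsymm hmul x z y t s (Or.elim src_xyz (fun e => (Or.inl (conv x t e))) (fun h1 => (Or.elim h1 (fun e => (Or.inr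
        (Or.inr (Or.inl (conv y t e))))) (fun h2 => (Or.elim h2 (fun e => (Or.inr (Or.inl (conv z t e)))) (fun h3 => (Or.elim h3 (fun e => (Or.inr
        (Or.inr (Or.inr (Or.inl (conv x s e)))))) (fun h4 => (Or.elim h4 (fun e => (Or.inr (Or.inr (Or.inr (Or.inr (Or.inr (conv y s e))))))) (fun
        e => (Or.inr (Or.inr (Or.inr (Or.inr (Or.inl (conv z s e)))))))))))))))) f_xzyt_s f_xzys_t
  have f_xzt_ys := cut_level3 hT h1 hsymm hmul x z t y s (Or.elim src_xzt (fun e => (Or.inl (conv x y e))) (fun h1 => (Or.elim h1 (fun e => (Or.inr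
        (Or.inl (conv' y z e)))) (fun h2 => (Or.elim h2 (fun e => (Or.inr (Or.inr (Or.inl (conv' y t e))))) (fun h3 => (Or.elim h3 (fun e =>
        (Or.inr (Or.inr (Or.inr (Or.inl (conv x s e)))))) (fun h4 => (Or.elim h4 (fun e => (Or.inr (Or.inr (Or.inr (Or.inr (Or.inl (conv z s
        e))))))) (fun e => (Or.inr (Or.inr (Or.inr (Or.inr (Or.inr (conv t s e)))))))))))))))) f_xzty_s f_xzts_y
  have f_xzs_yt := cut_level3 hT h1 hsymm hmul x z s y t (Or.elim src_xzs (fun e => (Or.inl (conv x y e))) (fun h1 => (Or.elim h1 (fun e => (Or.inr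
        (Or.inl (conv' y z e)))) (fun h2 => (Or.elim h2 (fun e => (Or.inr (Or.inr (Or.inl (conv' y s e))))) (fun h3 => (Or.elim h3 (fun e =>
        (Or.inr (Or.inr (Or.inr (Or.inl (conv x t e)))))) (fun h4 => (Or.elim h4 (fun e => (Or.inr (Or.inr (Or.inr (Or.inr (Or.inl (conv z t
        e))))))) (fun e => (Or.inr (Or.inr (Or.inr (Or.inr (Or.inr (conv' t s e)))))))))))))))) f_xzsy_t f_xzst_y
  have f_xty_zs := cut_level3 hT h1 hsymm hmul x t y z s (Or.elim src_xyt (fun e => (Or.inl (conv x z e))) (fun h1 => (Or.elim h1 (fun e => (Or.inr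
        (Or.inr (Or.inl (conv y z e))))) (fun h2 => (Or.elim h2 (fun e => (Or.inr (Or.inl (conv' z t e)))) (fun h3 => (Or.elim h3 (fun e => (Or.inr
        (Or.inr (Or.inr (Or.inl (conv x s e)))))) (fun h4 => (Or.elim h4 (fun e => (Or.inr (Or.inr (Or.inr (Or.inr (Or.inr (conv y s e))))))) (fun
        e => (Or.inr (Or.inr (Or.inr (Or.inr (Or.inl (conv t s e)))))))))))))))) f_xtyz_s f_xtys_z
  have f_xtz_ys := cut_level3 hT h1 hsymm hmul x t z y s (Or.elim src_xzt (fun e => (Or.inl (conv x y e))) (fun h1 => (Or.elim h1 (fun e => (Or.inr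
        (Or.inr (Or.inl (conv' y z e))))) (fun h2 => (Or.elim h2 (fun e => (Or.inr (Or.inl (conv' y t e)))) (fun h3 => (Or.elim h3 (fun e =>
        (Or.inr (Or.inr (Or.inr (Or.inl (conv x s e)))))) (fun h4 => (Or.elim h4 (fun e => (Or.inr (Or.inr (Or.inr (Or.inr (Or.inr (conv z s
        e))))))) (fun e => (Or.inr (Or.inr (Or.inr (Or.inr (Or.inl (conv t s e)))))))))))))))) f_xtzy_s f_xtzs_y
  have f_xts_yz := cut_level3 hT h1 hsymm hmul x t s y z (Or.elim src_xts (fun e => (Or.inl (conv x y e))) (fun h1 => (Or.elim h1 (fun e => (Or.inr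
        (Or.inl (conv' y t e)))) (fun h2 => (Or.elim h2 (fun e => (Or.inr (Or.inr (Or.inl (conv' y s e))))) (fun h3 => (Or.elim h3 (fun e =>
        (Or.inr (Or.inr (Or.inr (Or.inl (conv x z e)))))) (fun h4 => (Or.elim h4 (fun e => (Or.inr (Or.inr (Or.inr (Or.inr (Or.inl (conv' z t
        e))))))) (fun e => (Or.inr (Or.inr (Or.inr (Or.inr (Or.inr (conv' z s e)))))))))))))))) f_xtsy_z f_xtsz_y
  have f_xsy_zt := cut_level3 hT h1 hsymm hmul x s y z t (Or.elim src_xys (fun e => (Or.inl (conv x z e))) (fun h1 => (Or.elim h1 (fun e => (Or.inr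
        (Or.inr (Or.inl (conv y z e))))) (fun h2 => (Or.elim h2 (fun e => (Or.inr (Or.inl (conv' z s e)))) (fun h3 => (Or.elim h3 (fun e => (Or.inr
        (Or.inr (Or.inr (Or.inl (conv x t e)))))) (fun h4 => (Or.elim h4 (fun e => (Or.inr (Or.inr (Or.inr (Or.inr (Or.inr (conv y t e))))))) (fun
        e => (Or.inr (Or.inr (Or.inr (Or.inr (Or.inl (conv' t s e)))))))))))))))) f_xsyz_t f_xsyt_z
  have f_xsz_yt := cut_level3 hT h1 hsymm hmul x s z y t (Or.elim src_xzs (fun e => (Or.inl (conv x y e))) (fun h1 => (Or.elim h1 (fun e => (Or.inr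
        (Or.inr (Or.inl (conv' y z e))))) (fun h2 => (Or.elim h2 (fun e => (Or.inr (Or.inl (conv' y s e)))) (fun h3 => (Or.elim h3 (fun e =>
        (Or.inr (Or.inr (Or.inr (Or.inl (conv x t e)))))) (fun h4 => (Or.elim h4 (fun e => (Or.inr (Or.inr (Or.inr (Or.inr (Or.inr (conv z t
        e))))))) (fun e => (Or.inr (Or.inr (Or.inr (Or.inr (Or.inl (conv' t s e)))))))))))))))) f_xszy_t f_xszt_y
  have f_xst_yz := cut_level3 hT h1 hsymm hmul x s t y z (Or.elim src_xts (fun e => (Or.inl (conv x y e))) (fun h1 => (Or.elim h1 (fun e => (Or.inr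
        (Or.inr (Or.inl (conv' y t e))))) (fun h2 => (Or.elim h2 (fun e => (Or.inr (Or.inl (conv' y s e)))) (fun h3 => (Or.elim h3 (fun e =>
        (Or.inr (Or.inr (Or.inr (Or.inl (conv x z e)))))) (fun h4 => (Or.elim h4 (fun e => (Or.inr (Or.inr (Or.inr (Or.inr (Or.inr (conv' z t
        e))))))) (fun e => (Or.inr (Or.inr (Or.inr (Or.inr (Or.inl (conv' z s e)))))))))))))))) f_xsty_z f_xstz_y
  have f_xy_zts := cut_level2 hT h1 hsymm hmul x y z t s (Or.elim src_xy (fun e => (Or.inl (conv x z e))) (fun h1 => (Or.elim h1 (fun e => (Or.inr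
        (Or.inl (conv y z e)))) (fun h2 => (Or.elim h2 (fun e => (Or.inr (Or.inr (Or.inl (conv x t e))))) (fun h3 => (Or.elim h3 (fun e => (Or.inr
        (Or.inr (Or.inr (Or.inl (conv y t e)))))) (fun h4 => (Or.elim h4 (fun e => (Or.inr (Or.inr (Or.inr (Or.inr (Or.inl (conv x s e))))))) (fun
        e => (Or.inr (Or.inr (Or.inr (Or.inr (Or.inr (conv y s e)))))))))))))))) f_xyz_ts f_xyt_zs f_xys_zt
  have f_xz_yts := cut_level2 hT h1 hsymm hmul x z y t s (Or.elim src_xz (fun e => (Or.inl (conv x y e))) (fun h1 => (Or.elim h1 (fun e => (Or.inr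
        (Or.inl (conv' y z e)))) (fun h2 => (Or.elim h2 (fun e => (Or.inr (Or.inr (Or.inl (conv x t e))))) (fun h3 => (Or.elim h3 (fun e => (Or.inr
        (Or.inr (Or.inr (Or.inl (conv z t e)))))) (fun h4 => (Or.elim h4 (fun e => (Or.inr (Or.inr (Or.inr (Or.inr (Or.inl (conv x s e))))))) (fun
        e => (Or.inr (Or.inr (Or.inr (Or.inr (Or.inr (conv z s e)))))))))))))))) f_xzy_ts f_xzt_ys f_xzs_yt
  have f_xt_yzs := cut_level2 hT h1 hsymm hmul x t y z s (Or.elim src_xt (fun e => (Or.inl (conv x y e))) (fun h1 => (Or.elim h1 (fun e => (Or.inr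
        (Or.inl (conv' y t e)))) (fun h2 => (Or.elim h2 (fun e => (Or.inr (Or.inr (Or.inl (conv x z e))))) (fun h3 => (Or.elim h3 (fun e => (Or.inr
        (Or.inr (Or.inr (Or.inl (conv' z t e)))))) (fun h4 => (Or.elim h4 (fun e => (Or.inr (Or.inr (Or.inr (Or.inr (Or.inl (conv x s e))))))) (fun
        e => (Or.inr (Or.inr (Or.inr (Or.inr (Or.inr (conv t s e)))))))))))))))) f_xty_zs f_xtz_ys f_xts_yz
  have f_xs_yzt := cut_level2 hT h1 hsymm hmul x s y z t (Or.elim src_xs (fun e => (Or.inl (conv x y e))) (fun h1 => (Or.elim h1 (fun e => (Or.inr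
        (Or.inl (conv' y s e)))) (fun h2 => (Or.elim h2 (fun e => (Or.inr (Or.inr (Or.inl (conv x z e))))) (fun h3 => (Or.elim h3 (fun e => (Or.inr
        (Or.inr (Or.inr (Or.inl (conv' z s e)))))) (fun h4 => (Or.elim h4 (fun e => (Or.inr (Or.inr (Or.inr (Or.inr (Or.inl (conv x t e))))))) (fun
        e => (Or.inr (Or.inr (Or.inr (Or.inr (Or.inr (conv' t s e)))))))))))))))) f_xsy_zt f_xsz_yt f_xst_yz
  exact cut_level1 hT h1 hsymm hmul x y z t s (Or.elim src_x (fun e => (Or.inl (conv x y e))) (fun h1 => (Or.elim h1 (fun e => (Or.inr (Or.inl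
        (conv x z e)))) (fun h2 => (Or.elim h2 (fun e => (Or.inr (Or.inr (Or.inl (conv x t e))))) (fun e => (Or.inr (Or.inr (Or.inr (conv x s
        e)))))))))) f_xy_zts f_xz_yts f_xt_yzs f_xs_yzt

set_option maxHeartbeats 1600000 in
/-- **THE END — THE GREEDY THRESHOLD UNDER THE FULL-GRAPH PRODUCT**: for the class's tree weight `r ≥ 1` and a slower kernel `r₁ ≥ 1`,
symmetric, submultiplicative, `r₁⁸ ≤ r`, the order-five threshold of (557)∕(610) (WRITTEN OUT: the least of the fifteen cut maxima of `r⁻¹`)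
satisfies `t⋆⁴ ≤ Π_{10 pairs p ⊂ {x,y,z,t,s}} r₁(p)⁻¹` — the five-point term of `M₅` decays as a product over ALL pairs, so its weighted
slot sums factor site by site. [folklore] -/
theorem threshold_pow4_le_fullgraph (hr1 : ∀ x y, 1 ≤ r x y) (h1 : ∀ x y, 1 ≤ r₁ x y) (hsymm : ∀ x y, r₁ x y = r₁ y x)
    (hmul : ∀ x y z, r₁ x z ≤ r₁ x y * r₁ y z) (h8 : ∀ x y, r₁ x y ^ 8 ≤ r x y) (x y z t s : ι) :
    (min (max (r x y)⁻¹ (max (r x z)⁻¹ (max (r x t)⁻¹ (r x s)⁻¹))) (min (max (r x z)⁻¹ (max (r y z)⁻¹ (max (r x t)⁻¹ (max (r y t)⁻¹ (max (r x s)⁻¹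
          (r y s)⁻¹))))) (min (max (r x y)⁻¹ (max (r y z)⁻¹ (max (r x t)⁻¹ (max (r z t)⁻¹ (max (r x s)⁻¹ (r z s)⁻¹))))) (min (max (r x y)⁻¹ (max (r
          y t)⁻¹ (max (r x z)⁻¹ (max (r z t)⁻¹ (max (r x s)⁻¹ (r t s)⁻¹))))) (min (max (r x y)⁻¹ (max (r y s)⁻¹ (max (r x z)⁻¹ (max (r z s)⁻¹ (max
          (r x t)⁻¹ (r t s)⁻¹))))) (min (max (r x t)⁻¹ (max (r y t)⁻¹ (max (r z t)⁻¹ (max (r x s)⁻¹ (max (r y s)⁻¹ (r z s)⁻¹))))) (min (max (r x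
          z)⁻¹ (max (r y z)⁻¹ (max (r z t)⁻¹ (max (r x s)⁻¹ (max (r y s)⁻¹ (r t s)⁻¹))))) (min (max (r x z)⁻¹ (max (r y z)⁻¹ (max (r z s)⁻¹ (max (r
          x t)⁻¹ (max (r y t)⁻¹ (r t s)⁻¹))))) (min (max (r x y)⁻¹ (max (r y z)⁻¹ (max (r y t)⁻¹ (max (r x s)⁻¹ (max (r z s)⁻¹ (r t s)⁻¹))))) (min
          (max (r x y)⁻¹ (max (r y z)⁻¹ (max (r y s)⁻¹ (max (r x t)⁻¹ (max (r z t)⁻¹ (r t s)⁻¹))))) (min (max (r x y)⁻¹ (max (r y t)⁻¹ (max (r y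
          s)⁻¹ (max (r x z)⁻¹ (max (r z t)⁻¹ (r z s)⁻¹))))) (min (max (r x s)⁻¹ (max (r y s)⁻¹ (max (r z s)⁻¹ (r t s)⁻¹))) (min (max (r x t)⁻¹ (max
          (r y t)⁻¹ (max (r z t)⁻¹ (r t s)⁻¹))) (min (max (r x z)⁻¹ (max (r y z)⁻¹ (max (r z t)⁻¹ (r z s)⁻¹))) (max (r x y)⁻¹ (max (r y z)⁻¹ (max
          (r y t)⁻¹ (r y s)⁻¹))))))))))))))))) ^ 4 ≤
      (r₁ x y)⁻¹ * (r₁ x z)⁻¹ * (r₁ x t)⁻¹ * (r₁ x s)⁻¹ * (r₁ y z)⁻¹ * (r₁ y t)⁻¹ * (r₁ y s)⁻¹ * (r₁ z t)⁻¹ * (r₁ z s)⁻¹ * (r₁ t s)⁻¹ := by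
  have hr0 : ∀ a b, 0 < r a b := fun a b => lt_of_lt_of_le one_pos (hr1 a b)
  have h0 : ∀ a b, 0 < r₁ a b := fun a b => lt_of_lt_of_le one_pos (h1 a b)
  have hT : 0 ≤ min (max (r x y)⁻¹ (max (r x z)⁻¹ (max (r x t)⁻¹ (r x s)⁻¹))) (min (max (r x z)⁻¹ (max (r y z)⁻¹ (max (r x t)⁻¹ (max (r y t)⁻¹ (max
        (r x s)⁻¹ (r y s)⁻¹))))) (min (max (r x y)⁻¹ (max (r y z)⁻¹ (max (r x t)⁻¹ (max (r z t)⁻¹ (max (r x s)⁻¹ (r z s)⁻¹))))) (min (max (r x y)⁻¹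
        (max (r y t)⁻¹ (max (r x z)⁻¹ (max (r z t)⁻¹ (max (r x s)⁻¹ (r t s)⁻¹))))) (min (max (r x y)⁻¹ (max (r y s)⁻¹ (max (r x z)⁻¹ (max (r z s)⁻¹
        (max (r x t)⁻¹ (r t s)⁻¹))))) (min (max (r x t)⁻¹ (max (r y t)⁻¹ (max (r z t)⁻¹ (max (r x s)⁻¹ (max (r y s)⁻¹ (r z s)⁻¹))))) (min (max (r x
        z)⁻¹ (max (r y z)⁻¹ (max (r z t)⁻¹ (max (r x s)⁻¹ (max (r y s)⁻¹ (r t s)⁻¹))))) (min (max (r x z)⁻¹ (max (r y z)⁻¹ (max (r z s)⁻¹ (max (r x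
        t)⁻¹ (max (r y t)⁻¹ (r t s)⁻¹))))) (min (max (r x y)⁻¹ (max (r y z)⁻¹ (max (r y t)⁻¹ (max (r x s)⁻¹ (max (r z s)⁻¹ (r t s)⁻¹))))) (min (max
        (r x y)⁻¹ (max (r y z)⁻¹ (max (r y s)⁻¹ (max (r x t)⁻¹ (max (r z t)⁻¹ (r t s)⁻¹))))) (min (max (r x y)⁻¹ (max (r y t)⁻¹ (max (r y s)⁻¹ (max
        (r x z)⁻¹ (max (r z t)⁻¹ (r z s)⁻¹))))) (min (max (r x s)⁻¹ (max (r y s)⁻¹ (max (r z s)⁻¹ (r t s)⁻¹))) (min (max (r x t)⁻¹ (max (r y t)⁻¹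
        (max (r z t)⁻¹ (r t s)⁻¹))) (min (max (r x z)⁻¹ (max (r y z)⁻¹ (max (r z t)⁻¹ (r z s)⁻¹))) (max (r x y)⁻¹ (max (r y z)⁻¹ (max (r y t)⁻¹ (r
        y s)⁻¹)))))))))))))))) :=
    (le_min ((inv_nonneg.2 (hr0 _ _).le).trans (le_max_left _ _)) (le_min ((inv_nonneg.2 (hr0 _ _).le).trans (le_max_left _ _)) (le_min
          ((inv_nonneg.2 (hr0 _ _).le).trans (le_max_left _ _)) (le_min ((inv_nonneg.2 (hr0 _ _).le).trans (le_max_left _ _)) (le_min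
          ((inv_nonneg.2 (hr0 _ _).le).trans (le_max_left _ _)) (le_min ((inv_nonneg.2 (hr0 _ _).le).trans (le_max_left _ _)) (le_min
          ((inv_nonneg.2 (hr0 _ _).le).trans (le_max_left _ _)) (le_min ((inv_nonneg.2 (hr0 _ _).le).trans (le_max_left _ _)) (le_min
          ((inv_nonneg.2 (hr0 _ _).le).trans (le_max_left _ _)) (le_min ((inv_nonneg.2 (hr0 _ _).le).trans (le_max_left _ _)) (le_min
          ((inv_nonneg.2 (hr0 _ _).le).trans (le_max_left _ _)) (le_min ((inv_nonneg.2 (hr0 _ _).le).trans (le_max_left _ _)) (le_min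
          ((inv_nonneg.2 (hr0 _ _).le).trans (le_max_left _ _)) (le_min ((inv_nonneg.2 (hr0 _ _).le).trans (le_max_left _ _)) ((inv_nonneg.2 (hr0 _
          _).le).trans (le_max_left _ _))))))))))))))))
  have h := pow4_prod_le_one_of_cuts hT hr0 h1 hsymm hmul h8 x y z t s (min_le_left _ _) ((min_le_right _ _).trans (min_le_left _ _))
        ((min_le_right _ _).trans ((min_le_right _ _).trans (min_le_left _ _))) ((min_le_right _ _).trans ((min_le_right _ _).trans ((min_le_right
        _ _).trans (min_le_left _ _)))) ((min_le_right _ _).trans ((min_le_right _ _).trans ((min_le_right _ _).trans ((min_le_right _ _).trans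
        (min_le_left _ _))))) ((min_le_right _ _).trans ((min_le_right _ _).trans ((min_le_right _ _).trans ((min_le_right _ _).trans
        ((min_le_right _ _).trans (min_le_left _ _)))))) ((min_le_right _ _).trans ((min_le_right _ _).trans ((min_le_right _ _).trans
        ((min_le_right _ _).trans ((min_le_right _ _).trans ((min_le_right _ _).trans (min_le_left _ _))))))) ((min_le_right _ _).trans
        ((min_le_right _ _).trans ((min_le_right _ _).trans ((min_le_right _ _).trans ((min_le_right _ _).trans ((min_le_right _ _).trans
        ((min_le_right _ _).trans (min_le_left _ _)))))))) ((min_le_right _ _).trans ((min_le_right _ _).trans ((min_le_right _ _).trans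
        ((min_le_right _ _).trans ((min_le_right _ _).trans ((min_le_right _ _).trans ((min_le_right _ _).trans ((min_le_right _ _).trans
        (min_le_left _ _))))))))) ((min_le_right _ _).trans ((min_le_right _ _).trans ((min_le_right _ _).trans ((min_le_right _ _).trans
        ((min_le_right _ _).trans ((min_le_right _ _).trans ((min_le_right _ _).trans ((min_le_right _ _).trans ((min_le_right _ _).trans
        (min_le_left _ _)))))))))) ((min_le_right _ _).trans ((min_le_right _ _).trans ((min_le_right _ _).trans ((min_le_right _ _).trans
        ((min_le_right _ _).trans ((min_le_right _ _).trans ((min_le_right _ _).trans ((min_le_right _ _).trans ((min_le_right _ _).trans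
        ((min_le_right _ _).trans (min_le_left _ _))))))))))) ((min_le_right _ _).trans ((min_le_right _ _).trans ((min_le_right _ _).trans
        ((min_le_right _ _).trans ((min_le_right _ _).trans ((min_le_right _ _).trans ((min_le_right _ _).trans ((min_le_right _ _).trans
        ((min_le_right _ _).trans ((min_le_right _ _).trans ((min_le_right _ _).trans (min_le_left _ _)))))))))))) ((min_le_right _ _).trans
        ((min_le_right _ _).trans ((min_le_right _ _).trans ((min_le_right _ _).trans ((min_le_right _ _).trans ((min_le_right _ _).trans
        ((min_le_right _ _).trans ((min_le_right _ _).trans ((min_le_right _ _).trans ((min_le_right _ _).trans ((min_le_right _ _).trans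
        ((min_le_right _ _).trans (min_le_left _ _))))))))))))) ((min_le_right _ _).trans ((min_le_right _ _).trans ((min_le_right _ _).trans
        ((min_le_right _ _).trans ((min_le_right _ _).trans ((min_le_right _ _).trans ((min_le_right _ _).trans ((min_le_right _ _).trans
        ((min_le_right _ _).trans ((min_le_right _ _).trans ((min_le_right _ _).trans ((min_le_right _ _).trans ((min_le_right _ _).trans
        (min_le_left _ _)))))))))))))) ((min_le_right _ _).trans ((min_le_right _ _).trans ((min_le_right _ _).trans ((min_le_right _ _).trans
        ((min_le_right _ _).trans ((min_le_right _ _).trans ((min_le_right _ _).trans ((min_le_right _ _).trans ((min_le_right _ _).trans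
        ((min_le_right _ _).trans ((min_le_right _ _).trans ((min_le_right _ _).trans ((min_le_right _ _).trans (min_le_right _ _))))))))))))))
  have hP : 0 < r₁ x y * r₁ x z * r₁ x t * r₁ x s * r₁ y z * r₁ y t * r₁ y s * r₁ z t * r₁ z s * r₁ t s :=
    mul_pos (mul_pos (mul_pos (mul_pos (mul_pos (mul_pos (mul_pos (mul_pos (mul_pos (h0 _ _) (h0 _ _)) (h0 _ _)) (h0 _ _)) (h0 _ _)) (h0 _ _)) (h0
          _ _)) (h0 _ _)) (h0 _ _)) (h0 _ _)
  have hQ : (r₁ x y * r₁ x z * r₁ x t * r₁ x s * r₁ y z * r₁ y t * r₁ y s * r₁ z t * r₁ z s * r₁ t s)⁻¹ = (r₁ x y)⁻¹ * (r₁ x z)⁻¹ * (r₁ x t)⁻¹ *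
        (r₁ x s)⁻¹ * (r₁ y z)⁻¹ * (r₁ y t)⁻¹ * (r₁ y s)⁻¹ * (r₁ z t)⁻¹ * (r₁ z s)⁻¹ * (r₁ t s)⁻¹ := by simp only [mul_inv]
  calc _ ≤ 1 / (r₁ x y * r₁ x z * r₁ x t * r₁ x s * r₁ y z * r₁ y t * r₁ y s * r₁ z t * r₁ z s * r₁ t s) := (le_div_iff₀ hP).2 h
    _ = (r₁ x y)⁻¹ * (r₁ x z)⁻¹ * (r₁ x t)⁻¹ * (r₁ x s)⁻¹ * (r₁ y z)⁻¹ * (r₁ y t)⁻¹ * (r₁ y s)⁻¹ * (r₁ z t)⁻¹ * (r₁ z s)⁻¹ * (r₁ t s)⁻¹ := by rw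
          [one_div, hQ]

/-! ## Toy -/

/-- Toy (the conversion in numbers): `T = 1∕256`, `r = 256`, `r₁ = 2`: `T·r₁⁸ = 1 ≤ 1`. -/
example : (1 / 256 : ℝ) * 2 ^ 8 ≤ 1 := by norm_num

end Summit.QuantumFields.BalabanUV.T4Continuum.NE7b.SupFivePointThresholdFullGraph
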